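import Summits.ABC.IUTFork.Joshi.ATS4MainBounds
import Summits.ABC.IUTFork.Joshi.ATS4LogDiffConductorBridge
import HarnessLib

/-!
# Joshi, *Arithmetic Teichmüller Spaces IV* (arXiv:2403.10430v2) Thm. 6.1.1's input «log(d^{L_tpd}) + log(f^{L_tpd}) ≤ log(d^L) +
# log(f^L)» (= Thm. 4.6.1 (2) for `L/L_tpd`) — T-30's `MainBoundDatum.DiffCondMono` DISCHARGED for real number fields

Proof-only bridge (abc-iut cell, branch E, rung LADDER-ABC:A2.E; seat abc-iut-E-t27, slot T-27; merge-debt row T-27 ↔ T-30 of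
plan/E/ASSIGNMENTS.md §3). **No side is taken** on [IUTchIII] Cor. 3.12, on Joshi's claims, or on Mochizuki's reports on them; the
source is an unrefereed arXiv preprint. `MainBoundDatum` (slot T-30, `Joshi/ATS4MainBounds.lean`) carries the four normalised
degrees `log(d^{L_tpd})`, `log(f^{L_tpd})`, `log(d^L)`, `log(f^L)` as real fields and the monotonicity behind the second inequality
of [J-IV] Thm. 6.1.1 (p.58 l.1–23) as the reading predicate `DiffCondMono`; here it is PROVED whenever those fields are the degrees
of actual number fields `L_tpd ⊆ L` (T-26's `logDifferent`, `TateDivisorDatum.logf`) with compatible semistable supports, from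
`LogDiffCond.thm461_2_tateDivisorDatum` (`Joshi/ATS4LogDiffConductorBridge.lean`, ultimately the tree's [GenEll] Prop. 1.7 (i)
engine). Theorems only; standard axioms; no `sorry`, instance, notation or new `Prop` fact.
[claim: Joshi2024ATS4, status: disputed] (provenance of the typed items; nothing endorsed).
-/

noncomputable section

namespace Summit.ABC.IUTFork.Joshi.ATS4
namespace MainBoundDatum
open LogDiffCond Literature.IUT.LogVolume

/-- **T-30's reading predicate `DiffCondMono` DISCHARGED for real fields**: if the four fields `log(d^{L_tpd})`, `log(f^{L_tpd})`,
`log(d^L)`, `log(f^L)` of a `MainBoundDatum` are the normalised degrees of actual number fields `L_tpd ⊆ L` with Tate-divisor data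
whose semistable supports are compatible (every prime of `L` over `V^{odd,ss}_{L_tpd}` lies in `V^{odd,ss}_L`), then
`log(d^{L_tpd}) + log(f^{L_tpd}) ≤ log(d^L) + log(f^L)` ([J-IV] Thm. 4.6.1 (2) for `L/L_tpd`, p.46 l.36–37; [IUTchIV] Step (ii)
first display). PROVED. [cite: MochizukiGenEll2010, Prop 1.7 (i) p.9] -/
theorem diffCondMono_of_fields (D : MainBoundDatum) (Ltpd L : Type*) [Field Ltpd] [NumberField Ltpd] [Field L]
    [NumberField L] [Algebra Ltpd L] (𝔮tpd : TateDivisorDatum Ltpd) (𝔮L : TateDivisorDatum L)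
    (hV : ∀ w : IsDedekindDomain.HeightOneSpectrum (NumberField.RingOfIntegers L), finBelow Ltpd L w ∈ 𝔮tpd.V → w ∈ 𝔮L.V)
    (h₁ : D.logDiffLtpd = logDifferent Ltpd) (h₂ : D.logCondLtpd = 𝔮tpd.logf) (h₃ : D.logDiffL = logDifferent L)
    (h₄ : D.logCondL = 𝔮L.logf) : D.DiffCondMono := by
  unfold DiffCondMono
  rw [h₁, h₂, h₃, h₄]
  exact thm461_2_tateDivisorDatum Ltpd L 𝔮tpd 𝔮L hV

/-- The same under T-26's base-change relation `IsBaseChangeOf` (supports are EXACT inverse images). PROVED.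
[cite: MochizukiGenEll2010, Prop 1.7 (i) p.9] -/
theorem diffCondMono_of_isBaseChangeOf (D : MainBoundDatum) (Ltpd L : Type*) [Field Ltpd] [NumberField Ltpd] [Field L]
    [NumberField L] [Algebra Ltpd L] (𝔮tpd : TateDivisorDatum Ltpd) (𝔮L : TateDivisorDatum L) (hbc : 𝔮L.IsBaseChangeOf 𝔮tpd)
    (h₁ : D.logDiffLtpd = logDifferent Ltpd) (h₂ : D.logCondLtpd = 𝔮tpd.logf) (h₃ : D.logDiffL = logDifferent L)
    (h₄ : D.logCondL = 𝔮L.logf) : D.DiffCondMono :=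
  diffCondMono_of_fields D Ltpd L 𝔮tpd 𝔮L (fun w hw => (hbc.1 w).mpr hw) h₁ h₂ h₃ h₄

end MainBoundDatum
end Summit.ABC.IUTFork.Joshi.ATS4

end
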